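import Mathlib
import HarnessLib
import Summits.HubbardSuperconductivity.HubbardSuperconductivity.Theorems.KLProgrammeC4aFoldLevelLayer

/-!
# Route `KLProgramme` — crux C4a, S3 brick (B4) «(B4)-UMK1», (N5)/(M3) the LEVEL LAYER, SHARP FORM: the per-level `A·M^{−3/2}·(1 + log⁺(C₁M/e))` of the sharp signed
# fold law integrates to `A·K·|δ₀|^{−1/2}` with NO `log(1/|δ₀|)` — the log-free post-side `P`-hypothesis of the caustic pair layer

Cell `gate-hubbard-kl`, seat hubbard-kl-k3c3-p3 (g28; row «implicit-function / monotonicity route for μ(n)»).  Located brick for the (C)-closer lane hubbard-kl-c4a-1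
(stub (C) `stub_twoLeg_curvature` of `KLRegimeEngineV17F2`, stmt-HubbardSuperconductivity-20437), memo HOME/hubbard-kl-k3c3-p3/U1-CAUSTIC-SUP.md §7 (M3).
`…C4aFoldLevelLayer.intervalIntegral_fold_first_order_layer_le` integrates the per-level `(1 + log⁺(G/e))·A·M^{−3/2}` to `O(|δ₀|^{−1/2}·log²)`; the logarithms on
`|δ₀|^{−1/2}` are not integrable uniformly across a weakly transversal pair of caustic zeros (memo §3).  With the sharp fold law (`…C4aFoldSignedLawSharp`: the `X₀`-terms
carry only `log⁺(C₁M/e)`, `M = max(e,|m(e)|)`) the level integral is log-free: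
* §1 `posLog_le_two_sqrt` (`log⁺ y ≤ 2√y`), `one_add_posLog_level_le` (`1 + log⁺(C₁M/e) ≤ c₀ + log⁺(|δ₀|/e)` when `M ≤ |δ₀| + (1+λ₂)e`,
  `c₀ = 1 + log 2 + log⁺(C₁(1+λ₂)) + log⁺ C₁`);
* §2 **`intervalIntegral_fold_first_order_layer_sharp_le`**: `0 < lo ≤ hi`, `0 ≤ w ≤ W`, drift `δ₀ − λ₂e ≤ m(e) ≤ δ₀ − λ₁e` (`0 < λ₁ ≤ λ₂`), `|δ₀| > 0`, `0 ≤ C₁`,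
  `0 ≤ I(e) ≤ A·M⁻¹(√M)⁻¹·(1 + log⁺(C₁M/e))` ⟹
  `∫_{lo..hi} w·I ≤ W·A·(C₀·√C₀·(c₀ + 4) + 2c₀·(C₀/λ₁)·√(C₀/λ₁))·(√|δ₀|)⁻¹`, `C₀ = 4 + 2λ₂ + λ₁` — NO `log(1/|δ₀|)`, NO `lo`
  (small levels `e ≤ |δ₀|`: `M ≥ |δ₀|/C₀`, `log⁺(|δ₀|/e) ≤ 2√(|δ₀|/e)`, `∫ e^{−1/2}`; large levels: `M ≥ λ₁e/C₀`, `∫ e^{−3/2} ≤ 2/√|δ₀|`).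
Pure real analysis.  References: Salmhofer 1999 §4.5.3 [cite: Salmhofer1999]; FST II CPAM 51 (1998) §3 [cite: FeldmanSalmhoferTrubowitz1998].
-/

noncomputable section

namespace Summit.HubbardSuperconductivity.HubbardSuperconductivity.Theorems.C4a

set_option linter.dupNamespace false -- summit = problem name (single-conjunct summit), D-0017

open Real Set MeasureTheory intervalIntegral

/-! ## §1 Logarithm bookkeeping -/

/-- `log⁺ y ≤ 2√y` for `y ≥ 0`. -/
theorem posLog_le_two_sqrt {y : ℝ} (hy : 0 ≤ y) : log⁺ y ≤ 2 * Real.sqrt y := by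
  rcases le_or_gt y 1 with h | h
  · rw [(Real.posLog_eq_zero_iff y).2 (by rw [abs_of_nonneg hy]; exact h)]; positivity
  · rw [Real.posLog_eq_log (by rw [abs_of_nonneg hy]; exact h.le)]
    have h1 := Real.log_le_rpow_div hy (by norm_num : (0 : ℝ) < 1 / 2)
    rw [← Real.sqrt_eq_rpow] at h1
    linarith

/-- **Level logarithm**: `0 < e`, `0 ≤ C₁`, `0 ≤ λ₂`, `0 ≤ M ≤ d + (1+λ₂)e` (`d ≥ 0`) ⟹ `1 + log⁺(C₁M/e) ≤ (1 + log 2 + log⁺(C₁(1+λ₂)) + log⁺ C₁) + log⁺(d/e)`. -/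
theorem one_add_posLog_level_le {e C₁ la₂ M d : ℝ} (he : 0 < e) (hC₁ : 0 ≤ C₁) (hla₂ : 0 ≤ la₂) (hd : 0 ≤ d) (hM0 : 0 ≤ M)
    (hM : M ≤ d + (1 + la₂) * e) :
    1 + log⁺ (C₁ * M / e) ≤ (1 + Real.log 2 + log⁺ (C₁ * (1 + la₂)) + log⁺ C₁) + log⁺ (d / e) := by
  have hposlog : ∀ y : ℝ, 0 ≤ log⁺ y := fun _ => Real.posLog_nonneg
  set a : ℝ := C₁ * (1 + la₂) with ha
  set b : ℝ := C₁ * (d / e) with hb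
  have ha0 : 0 ≤ a := by positivity
  have hb0 : 0 ≤ b := by positivity
  have h1 : C₁ * M / e ≤ a + b := by
    rw [div_le_iff₀ he, ha, hb]
    have := mul_le_mul_of_nonneg_left hM hC₁
    have e1 : (C₁ * (1 + la₂) + C₁ * (d / e)) * e = C₁ * (d + (1 + la₂) * e) := by field_simp; ring
    rw [e1]; exact this
  have h2 : log⁺ (C₁ * M / e) ≤ log⁺ (2 * max a b) :=
    Real.posLog_le_posLog (by positivity) (h1.trans (by linarith [le_max_left a b, le_max_right a b]))
  have h3 : log⁺ (2 * max a b) ≤ Real.log 2 + (log⁺ a + log⁺ b) := by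
    have h := Real.posLog_mul (x := 2) (y := max a b)
    have h2' : log⁺ (2 : ℝ) = Real.log 2 := Real.posLog_eq_log (by norm_num)
    have hmax : log⁺ (max a b) ≤ log⁺ a + log⁺ b := by
      rcases le_total a b with hab | hab
      · rw [max_eq_right hab]; linarith [hposlog a]
      · rw [max_eq_left hab]; linarith [hposlog b]
    linarith
  have h4 : log⁺ b ≤ log⁺ C₁ + log⁺ (d / e) := Real.posLog_mul
  linarith

/-! ## §2 The sharp level layer -/
set_option maxHeartbeats 400000 in
/-- **THE LEVEL LAYER, SHARP FORM** (see the module docstring): the per-level `A·M⁻¹(√M)⁻¹·(1 + log⁺(C₁M/e))` integrates against `0 ≤ w ≤ W` over `[lo, hi]` to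
`W·A·(C₀√C₀(c₀ + 4) + 2c₀(C₀/λ₁)√(C₀/λ₁))·(√|δ₀|)⁻¹`, `C₀ = 4 + 2λ₂ + λ₁`, `c₀ = 1 + log 2 + log⁺(C₁(1+λ₂)) + log⁺ C₁` — no `log(1/|δ₀|)`, no `lo`.
(No integrability hypothesis on `I`.) -/
theorem intervalIntegral_fold_first_order_layer_sharp_le {lo hi W A C₁ δ₀ la₁ la₂ : ℝ} {w I m : ℝ → ℝ} (hlo : 0 < lo) (hlohi : lo ≤ hi) (hW : 0 ≤ W)
    (hA : 0 ≤ A) (hC₁ : 0 ≤ C₁) (hla₁ : 0 < la₁) (hla₁₂ : la₁ ≤ la₂) (hδ₀ : 0 < |δ₀|)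
    (hdrift : ∀ e ∈ Icc lo hi, δ₀ - la₂ * e ≤ m e ∧ m e ≤ δ₀ - la₁ * e)
    (hw0 : ∀ e ∈ Icc lo hi, 0 ≤ w e) (hw : ∀ e ∈ Icc lo hi, w e ≤ W) (hI0 : ∀ e ∈ Icc lo hi, 0 ≤ I e)
    (hI : ∀ e ∈ Icc lo hi, I e ≤ A * ((max e |m e|)⁻¹ * (Real.sqrt (max e |m e|))⁻¹) * (1 + log⁺ (C₁ * max e |m e| / e))) :
    ∫ e in lo..hi, w e * I e ≤
      W * A * ((4 + 2 * la₂ + la₁) * Real.sqrt (4 + 2 * la₂ + la₁) * ((1 + Real.log 2 + log⁺ (C₁ * (1 + la₂)) + log⁺ C₁) + 4) +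
        2 * (1 + Real.log 2 + log⁺ (C₁ * (1 + la₂)) + log⁺ C₁) * ((4 + 2 * la₂ + la₁) / la₁ * Real.sqrt ((4 + 2 * la₂ + la₁) / la₁))) *
        (Real.sqrt |δ₀|)⁻¹ := by
  obtain ⟨C, hC⟩ : ∃ C : ℝ, C = 4 + 2 * la₂ + la₁ := ⟨_, rfl⟩
  obtain ⟨d, hd⟩ : ∃ d : ℝ, d = |δ₀| := ⟨_, rfl⟩
  obtain ⟨c₀, hc₀⟩ : ∃ c₀ : ℝ, c₀ = 1 + Real.log 2 + log⁺ (C₁ * (1 + la₂)) + log⁺ C₁ := ⟨_, rfl⟩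
  have hCpos : 0 < C := by rw [hC]; linarith
  have hdpos : 0 < d := by rw [hd]; exact hδ₀
  have hla₂ : 0 ≤ la₂ := hla₁.le.trans hla₁₂
  have hposlog : ∀ y : ℝ, 0 ≤ log⁺ y := fun _ => Real.posLog_nonneg
  have hlog2 : 0 ≤ Real.log 2 := Real.log_nonneg (by norm_num)
  have hc₀1 : 1 ≤ c₀ := by rw [hc₀]; linarith [hposlog (C₁ * (1 + la₂)), hposlog C₁]
  have hc₀0 : 0 ≤ c₀ := by linarith
  rw [← hC, ← hd, ← hc₀]
  have hsd : 0 < Real.sqrt d := Real.sqrt_pos.2 hdpos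
  -- the constant
  obtain ⟨Kc, hKc⟩ : ∃ Kc : ℝ, Kc = C * Real.sqrt C * (c₀ + 4) + 2 * c₀ * (C / la₁ * Real.sqrt (C / la₁)) := ⟨_, rfl⟩
  have hKc0 : 0 ≤ Kc := by rw [hKc]; positivity
  rw [← hKc]
  have hRHS0 : 0 ≤ W * A * Kc * (Real.sqrt d)⁻¹ := by positivity
  by_cases hint : IntervalIntegrable (fun e => w e * I e) volume lo hi
  swap
  · rw [intervalIntegral.integral_undef hint]; exact hRHS0
  -- the profile: `(d + λ₁e)/C ≤ M ≤ d + (1+λ₂)e`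
  have hP : ∀ e ∈ Icc lo hi, (d + la₁ * e) / C ≤ max e |m e| := fun e he => by
    rw [hC, hd]; exact profile_le_max_of_drift (hlo.le.trans he.1) hla₁ hla₁₂ (hdrift e he).1 (hdrift e he).2
  have hU : ∀ e ∈ Icc lo hi, max e |m e| ≤ d + (1 + la₂) * e := fun e he => by
    have he0 : 0 ≤ e := hlo.le.trans he.1
    refine max_le (by nlinarith [hdpos.le]) ?_
    rw [hd]
    have h1 := (hdrift e he).1
    have h2 := (hdrift e he).2
    rw [abs_le]; constructor
    · have := neg_abs_le δ₀; nlinarith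
    · have := le_abs_self δ₀; nlinarith
  -- pointwise: `I e ≤ A·P(e)^{−3/2}·(c₀ + log⁺(d/e))`
  have hpt : ∀ e ∈ Icc lo hi, I e ≤ A * (((d + la₁ * e) / C)⁻¹ * (Real.sqrt ((d + la₁ * e) / C))⁻¹) * (c₀ + log⁺ (d / e)) := fun e he => by
    have he0 : 0 < e := hlo.trans_le he.1
    have hPpos : 0 < (d + la₁ * e) / C := by positivity
    have hM0 : 0 < max e |m e| := lt_max_of_lt_left he0
    have h1 : (max e |m e|)⁻¹ * (Real.sqrt (max e |m e|))⁻¹ ≤ ((d + la₁ * e) / C)⁻¹ * (Real.sqrt ((d + la₁ * e) / C))⁻¹ :=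
      mul_le_mul (inv_anti₀ hPpos (hP e he)) (inv_anti₀ (Real.sqrt_pos.2 hPpos) (Real.sqrt_le_sqrt (hP e he)))
        (inv_nonneg.2 (Real.sqrt_nonneg _)) (by positivity)
    have h2 : 1 + log⁺ (C₁ * max e |m e| / e) ≤ c₀ + log⁺ (d / e) := by
      rw [hc₀]; exact one_add_posLog_level_le he0 hC₁ hla₂ hdpos.le hM0.le (hU e he)
    have h3 : 0 ≤ 1 + log⁺ (C₁ * max e |m e| / e) := by linarith [hposlog (C₁ * max e |m e| / e)]
    calc I e ≤ A * ((max e |m e|)⁻¹ * (Real.sqrt (max e |m e|))⁻¹) * (1 + log⁺ (C₁ * max e |m e| / e)) := hI e he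
      _ ≤ A * (((d + la₁ * e) / C)⁻¹ * (Real.sqrt ((d + la₁ * e) / C))⁻¹) * (c₀ + log⁺ (d / e)) :=
          mul_le_mul (mul_le_mul_of_nonneg_left h1 hA) h2 h3 (by positivity)
  -- threshold
  obtain ⟨θ, hθ⟩ : ∃ θ : ℝ, θ = max lo (min d hi) := ⟨_, rfl⟩
  have hloθ : lo ≤ θ := by rw [hθ]; exact le_max_left _ _
  have hθhi : θ ≤ hi := by rw [hθ]; exact max_le hlohi (min_le_right _ _)
  have hθpos : 0 < θ := hlo.trans_le hloθ
  -- small levels `e ∈ [lo, θ]` have `e ≤ d` unless the piece is degenerate; large levels `e ∈ [θ, hi]` have `d ≤ e` unless degenerate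
  have hi1 : IntervalIntegrable (fun e => w e * I e) volume lo θ :=
    hint.mono_set (by rw [uIcc_of_le hlohi, uIcc_of_le hloθ]; exact Icc_subset_Icc le_rfl hθhi)
  have hi2 : IntervalIntegrable (fun e => w e * I e) volume θ hi :=
    hint.mono_set (by rw [uIcc_of_le hlohi, uIcc_of_le hθhi]; exact Icc_subset_Icc hloθ le_rfl)
  rw [← integral_add_adjacent_intervals hi1 hi2]
  have hwI0 : ∀ e ∈ Icc lo hi, 0 ≤ w e * I e := fun e he => mul_nonneg (hw0 e he) (hI0 e he)
  -- two antiderivative facts on positive intervals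
  have hFTC1 : ∀ a b : ℝ, 0 < a → a ≤ b → ∫ e in a..b, (Real.sqrt e)⁻¹ = 2 * Real.sqrt b - 2 * Real.sqrt a := by
    intro a b ha hab
    have hne : ∀ x ∈ uIcc a b, x ≠ 0 := fun x hx => by rw [uIcc_of_le hab] at hx; exact (ha.trans_le hx.1).ne'
    have hderiv : ∀ x ∈ uIcc a b, HasDerivAt (fun e => 2 * Real.sqrt e) ((Real.sqrt x)⁻¹) x := fun x hx => by
      have h := (Real.hasDerivAt_sqrt (hne x hx)).const_mul 2
      refine h.congr_deriv ?_
      have : 0 < Real.sqrt x := Real.sqrt_pos.2 ((ha.trans_le (by rw [uIcc_of_le hab] at hx; exact hx.1)))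
      field_simp
    have hcont : ContinuousOn (fun e : ℝ => (Real.sqrt e)⁻¹) (uIcc a b) :=
      ContinuousOn.inv₀ Real.continuous_sqrt.continuousOn fun x hx =>
        (Real.sqrt_pos.2 (ha.trans_le (by rw [uIcc_of_le hab] at hx; exact hx.1))).ne'
    rw [integral_eq_sub_of_hasDerivAt hderiv hcont.intervalIntegrable]
  have hFTC2 : ∀ a b : ℝ, 0 < a → a ≤ b → ∫ e in a..b, e⁻¹ * (Real.sqrt e)⁻¹ = 2 * (Real.sqrt a)⁻¹ - 2 * (Real.sqrt b)⁻¹ := by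
    intro a b ha hab
    have hpos : ∀ x ∈ uIcc a b, 0 < x := fun x hx => by rw [uIcc_of_le hab] at hx; exact ha.trans_le hx.1
    have hderiv : ∀ x ∈ uIcc a b, HasDerivAt (fun e => -2 * (Real.sqrt e)⁻¹) (x⁻¹ * (Real.sqrt x)⁻¹) x := fun x hx => by
      have hx0 := hpos x hx
      have hsx : 0 < Real.sqrt x := Real.sqrt_pos.2 hx0
      have h := ((Real.hasDerivAt_sqrt hx0.ne').inv hsx.ne').const_mul (-2)
      refine h.congr_deriv ?_
      have hsq : Real.sqrt x ^ 2 = x := Real.sq_sqrt hx0.le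
      rw [hsq]
      field_simp
    have hcont : ContinuousOn (fun e : ℝ => e⁻¹ * (Real.sqrt e)⁻¹) (uIcc a b) :=
      (continuousOn_id.inv₀ fun x hx => (hpos x hx).ne').mul
        (ContinuousOn.inv₀ Real.continuous_sqrt.continuousOn fun x hx => (Real.sqrt_pos.2 (hpos x hx)).ne')
    rw [integral_eq_sub_of_hasDerivAt hderiv hcont.intervalIntegrable]
    ring
  -- (1) small levels
  have hsmall : ∫ e in lo..θ, w e * I e ≤ W * A * (C * Real.sqrt C * (c₀ + 4)) * (Real.sqrt d)⁻¹ := by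
    have hS0 : 0 ≤ W * A * (C * Real.sqrt C * (c₀ + 4)) * (Real.sqrt d)⁻¹ := by positivity
    rcases le_or_gt d lo with hdlo | hdlo
    · have : θ = lo := by rw [hθ]; exact max_eq_left ((min_le_left _ _).trans hdlo)
      rw [this, intervalIntegral.integral_same]; exact hS0
    · have hθd : θ ≤ d := by rw [hθ]; exact max_le hdlo.le (min_le_left _ _)
      have hsC : 0 < Real.sqrt C := Real.sqrt_pos.2 hCpos
      -- `Zd = (C/d)·(√C/√d)`
      have hZ1 : (d / C)⁻¹ = C / d := inv_div d C
      have hZ2 : (Real.sqrt (d / C))⁻¹ = Real.sqrt C * (Real.sqrt d)⁻¹ := by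
        rw [Real.sqrt_div' d hCpos.le, inv_div, div_eq_mul_inv]
      set Kd : ℝ := W * A * (C / d * (Real.sqrt C * (Real.sqrt d)⁻¹)) with hKd
      have hKd0 : 0 ≤ Kd := by positivity
      set g₁ : ℝ → ℝ := fun e => Kd * (c₀ + 2 * Real.sqrt d * (Real.sqrt e)⁻¹) with hg₁
      have hinvs : ContinuousOn (fun e : ℝ => (Real.sqrt e)⁻¹) (uIcc lo θ) :=
        ContinuousOn.inv₀ Real.continuous_sqrt.continuousOn fun x hx =>
          (Real.sqrt_pos.2 (hlo.trans_le (by rw [uIcc_of_le hloθ] at hx; exact hx.1))).ne'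
      have hg₁c : ContinuousOn g₁ (uIcc lo θ) := continuousOn_const.mul (continuousOn_const.add (continuousOn_const.mul hinvs))
      have hg₁i : IntervalIntegrable g₁ volume lo θ := hg₁c.intervalIntegrable
      -- pointwise on the small piece
      have hle : ∫ e in lo..θ, w e * I e ≤ ∫ e in lo..θ, g₁ e := by
        refine intervalIntegral.integral_mono_on hloθ hi1 hg₁i fun e he => ?_
        have heI : e ∈ Icc lo hi := ⟨he.1, he.2.trans hθhi⟩
        have he0 : 0 < e := hlo.trans_le he.1
        have hed : e ≤ d := he.2.trans hθd
        have hPe : d / C ≤ (d + la₁ * e) / C := div_le_div_of_nonneg_right (by nlinarith [hla₁.le, he0.le]) hCpos.le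
        have hdC : 0 < d / C := by positivity
        have h1 : ((d + la₁ * e) / C)⁻¹ * (Real.sqrt ((d + la₁ * e) / C))⁻¹ ≤ C / d * (Real.sqrt C * (Real.sqrt d)⁻¹) := by
          rw [← hZ1, ← hZ2]
          exact mul_le_mul (inv_anti₀ hdC hPe) (inv_anti₀ (Real.sqrt_pos.2 hdC) (Real.sqrt_le_sqrt hPe))
            (inv_nonneg.2 (Real.sqrt_nonneg _)) (by positivity)
        have h2 : log⁺ (d / e) ≤ 2 * Real.sqrt d * (Real.sqrt e)⁻¹ :=
          calc log⁺ (d / e) ≤ 2 * Real.sqrt (d / e) := posLog_le_two_sqrt (show 0 ≤ d / e by positivity)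
            _ = 2 * Real.sqrt d * (Real.sqrt e)⁻¹ := by rw [Real.sqrt_div' d he0.le]; ring
        have h3 := hpt e heI
        have h4 : A * (((d + la₁ * e) / C)⁻¹ * (Real.sqrt ((d + la₁ * e) / C))⁻¹) * (c₀ + log⁺ (d / e)) ≤
            A * (C / d * (Real.sqrt C * (Real.sqrt d)⁻¹)) * (c₀ + 2 * Real.sqrt d * (Real.sqrt e)⁻¹) :=
          mul_le_mul (mul_le_mul_of_nonneg_left h1 hA) (by linarith) (by linarith [hposlog (d / e)]) (by positivity)
        have h5 : w e * I e ≤ W * (A * (C / d * (Real.sqrt C * (Real.sqrt d)⁻¹)) * (c₀ + 2 * Real.sqrt d * (Real.sqrt e)⁻¹)) :=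
          mul_le_mul (hw e heI) (h3.trans h4) (hI0 e heI) hW
        simp only [hg₁, hKd]
        linarith
      refine hle.trans ?_
      -- the value of the majorant
      have hval : ∫ e in lo..θ, g₁ e = Kd * (c₀ * (θ - lo) + 2 * Real.sqrt d * (2 * Real.sqrt θ - 2 * Real.sqrt lo)) := by
        simp only [hg₁]
        rw [intervalIntegral.integral_const_mul, intervalIntegral.integral_add intervalIntegrable_const (hinvs.intervalIntegrable.const_mul _),
          intervalIntegral.integral_const, intervalIntegral.integral_const_mul, hFTC1 lo θ hlo hloθ, smul_eq_mul]
        ring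
      rw [hval]
      have hsθ : Real.sqrt θ ≤ Real.sqrt d := Real.sqrt_le_sqrt hθd
      have hslo : 0 ≤ Real.sqrt lo := Real.sqrt_nonneg _
      have hsdd : Real.sqrt d * Real.sqrt d = d := Real.mul_self_sqrt hdpos.le
      have hin : c₀ * (θ - lo) + 2 * Real.sqrt d * (2 * Real.sqrt θ - 2 * Real.sqrt lo) ≤ (c₀ + 4) * d := by
        have := mul_le_mul_of_nonneg_left hsθ (by positivity : 0 ≤ 2 * Real.sqrt d)
        nlinarith [hsdd, hc₀0, hlo.le, hθd]
      calc Kd * (c₀ * (θ - lo) + 2 * Real.sqrt d * (2 * Real.sqrt θ - 2 * Real.sqrt lo)) ≤ Kd * ((c₀ + 4) * d) :=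
            mul_le_mul_of_nonneg_left hin hKd0
        _ = W * A * (C * Real.sqrt C * (c₀ + 4)) * (Real.sqrt d)⁻¹ := by
            simp only [hKd]; field_simp
  -- (2) large levels
  have hlarge : ∫ e in θ..hi, w e * I e ≤ W * A * (2 * c₀ * (C / la₁ * Real.sqrt (C / la₁))) * (Real.sqrt d)⁻¹ := by
    have hL0 : 0 ≤ W * A * (2 * c₀ * (C / la₁ * Real.sqrt (C / la₁))) * (Real.sqrt d)⁻¹ := by positivity
    rcases lt_or_ge hi d with hhid | hhid
    · -- degenerate: `θ = hi`
      have : θ = hi := by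
        rw [hθ, min_eq_right hhid.le]; exact max_eq_right hlohi
      rw [this, intervalIntegral.integral_same]; exact hL0
    · have hθd : d ≤ θ := by
        rw [hθ, min_eq_left hhid]; exact le_max_right _ _
      set K₂ : ℝ := W * A * (c₀ * (C / la₁ * Real.sqrt (C / la₁))) with hK₂
      have hK₂0 : 0 ≤ K₂ := by positivity
      set g₂ : ℝ → ℝ := fun e => K₂ * (e⁻¹ * (Real.sqrt e)⁻¹) with hg₂
      have hposθ : ∀ x ∈ uIcc θ hi, 0 < x := fun x hx => by rw [uIcc_of_le hθhi] at hx; exact hθpos.trans_le hx.1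
      have hprodc : ContinuousOn (fun e : ℝ => e⁻¹ * (Real.sqrt e)⁻¹) (uIcc θ hi) :=
        (continuousOn_id.inv₀ fun x hx => (hposθ x hx).ne').mul
          (ContinuousOn.inv₀ Real.continuous_sqrt.continuousOn fun x hx => (Real.sqrt_pos.2 (hposθ x hx)).ne')
      have hg₂i : IntervalIntegrable g₂ volume θ hi := (continuousOn_const.mul hprodc).intervalIntegrable
      have hle : ∫ e in θ..hi, w e * I e ≤ ∫ e in θ..hi, g₂ e := by
        refine intervalIntegral.integral_mono_on hθhi hi2 hg₂i fun e he => ?_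
        have heI : e ∈ Icc lo hi := ⟨hloθ.trans he.1, he.2⟩
        have he0 : 0 < e := hlo.trans_le heI.1
        have hde : d ≤ e := hθd.trans he.1
        have hPe : la₁ * e / C ≤ (d + la₁ * e) / C := div_le_div_of_nonneg_right (by linarith) hCpos.le
        have hq : 0 < la₁ * e / C := by positivity
        have h1 : ((d + la₁ * e) / C)⁻¹ * (Real.sqrt ((d + la₁ * e) / C))⁻¹ ≤ (C / la₁ * e⁻¹) * (Real.sqrt (C / la₁) * (Real.sqrt e)⁻¹) := by
          have e1 : (la₁ * e / C)⁻¹ = C / la₁ * e⁻¹ := by field_simp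
          have e2 : (Real.sqrt (la₁ * e / C))⁻¹ = Real.sqrt (C / la₁) * (Real.sqrt e)⁻¹ := by
            rw [show la₁ * e / C = e / (C / la₁) by field_simp, Real.sqrt_div' e (by positivity : 0 ≤ C / la₁), inv_div, div_eq_mul_inv]
          rw [← e1, ← e2]
          exact mul_le_mul (inv_anti₀ hq hPe) (inv_anti₀ (Real.sqrt_pos.2 hq) (Real.sqrt_le_sqrt hPe))
            (inv_nonneg.2 (Real.sqrt_nonneg _)) (by positivity)
        have h2 : log⁺ (d / e) = 0 := (Real.posLog_eq_zero_iff _).2 (by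
          rw [abs_of_nonneg (by positivity)]; exact (div_le_one he0).2 hde)
        have h3 := hpt e heI
        rw [h2, add_zero] at h3
        have h4 : A * (((d + la₁ * e) / C)⁻¹ * (Real.sqrt ((d + la₁ * e) / C))⁻¹) * c₀ ≤
            A * ((C / la₁ * e⁻¹) * (Real.sqrt (C / la₁) * (Real.sqrt e)⁻¹)) * c₀ :=
          mul_le_mul_of_nonneg_right (mul_le_mul_of_nonneg_left h1 hA) hc₀0
        have h5 : w e * I e ≤ W * (A * ((C / la₁ * e⁻¹) * (Real.sqrt (C / la₁) * (Real.sqrt e)⁻¹)) * c₀) :=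
          mul_le_mul (hw e heI) (h3.trans h4) (hI0 e heI) hW
        have e3 : W * (A * ((C / la₁ * e⁻¹) * (Real.sqrt (C / la₁) * (Real.sqrt e)⁻¹)) * c₀) = g₂ e := by
          simp only [hg₂, hK₂]; ring
        linarith [e3]
      refine hle.trans ?_
      have hval : ∫ e in θ..hi, g₂ e = K₂ * (2 * (Real.sqrt θ)⁻¹ - 2 * (Real.sqrt hi)⁻¹) := by
        simp only [hg₂]
        rw [intervalIntegral.integral_const_mul, hFTC2 θ hi hθpos hθhi]
      rw [hval]
      have h6 : (Real.sqrt θ)⁻¹ ≤ (Real.sqrt d)⁻¹ := inv_anti₀ hsd (Real.sqrt_le_sqrt hθd)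
      have h7 : 0 ≤ (Real.sqrt hi)⁻¹ := inv_nonneg.2 (Real.sqrt_nonneg _)
      calc K₂ * (2 * (Real.sqrt θ)⁻¹ - 2 * (Real.sqrt hi)⁻¹) ≤ K₂ * (2 * (Real.sqrt d)⁻¹) := by
            refine mul_le_mul_of_nonneg_left ?_ hK₂0; linarith
        _ = W * A * (2 * c₀ * (C / la₁ * Real.sqrt (C / la₁))) * (Real.sqrt d)⁻¹ := by simp only [hK₂]; ring
  -- (3) sum
  have hsum := add_le_add hsmall hlarge
  refine hsum.trans (le_of_eq ?_)
  rw [hKc]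
  ring

end Summit.HubbardSuperconductivity.HubbardSuperconductivity.Theorems.C4a

end
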